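import Summits.QuantumFields.YangMills.Theorems.BalabanUVNodesN19TiltPathMixture

/-!
# BalabanUVNodes ∕ N19 — THE ANNEALED (TILT-PATH) ROAD, VI: THE CIRCLE — ROAD III's CONVERSE `tiltPath_of_mass_of_tv`, THE EQUIVALENCE
# {∃ tilt path with DRIFT(r₁) ∧ OSC(2ρ)} ⟺ MASS_cl(r₁) ∧ TV_cl(ρ), AND THE OSC-OPTIMALITY OF THE MIXTURE PATH

Cell `pub-ymgap` (HUMAN RULING D-0062, Track A), node N19 = NE7, R134 seat `pub-ymgap-dag-n19-c` (g17); second of two modules of bus INTENT-24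
(dag-lead g10 DEDUP GO «path free; 22 new names free»).  LENS control memo v6.2 §D (D3)(iii) VERBATIM — «OPTIONAL one-lemma converse that would print the
⟺ in the tree (idle seat only, nobody's duty, credit free): `tiltPath_of_mass_of_tv` — MASS_cl(r₁) ∧ TV_cl(ρ) ∧ bounded class log-densities ⇒ a tilt
path with DRIFT(r₁) ∧ OSC(2ρ) in III's letters (K13a∕b∕c + the clamp)» — re-offered to the N19 pens by dag-n14-c g8 (bus l.19410, l.19949); the lens's
`Sketch-control-g9.lean` 27be075ad5a82fec §2 (K13) CREDITED (module V carries its one-class calculus).  Filed `--kind proof --supports` K3⁶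
`SpineGivenEndpointR13SepCoPR` = stmt-QuantumFields-20509 `--as helper`.  COUNT-NEUTRAL.  THEOREMS ONLY (0 `def`); imports module V
`…N19TiltPathMixture` (hence road III∕II∕I and 16a∕16b); edits nothing.

WHAT IS PROVED ([folklore] measure arithmetic; road II∕III and 16b BY NAME).
* §1 ONE CLASS, TV SIDE (`μ` finite `≠ 0`, `|ψ₁| ≤ M`, `μB = e^{ψ₁}·μ`, `Z = ∫e^{ψ₁}dμ ∕ m`, `ρ = e^{ψ₁}∕Z`): `integral_abs_sub_one_eq` (split at `S₊ = {ρ > 1}`) ·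
  `setDiff_eq_integral` (16b's TV_cl difference on `S` is `(1∕m)∫_S (ρ−1)dμ`) · ★ `integral_abs_sub_one_le_of_tv` (set-closeness `≤ ρ₀` on all measurable
  sets ⇒ `(1∕m)∫|ρ−1|dμ ≤ 2ρ₀`) · `half_integral_abs_eq_setDiff_pos` (`½(1∕m)∫|ρ−1|dμ` IS the difference at `S₊`: the total-variation distance, attained) ·
  ★ `osc_mixture_le_of_pathOsc` (OSC-OPTIMALITY: for EVERY tilt path with road II's letters from `ψ 0 = 0` to `ψ 1 = ψ₁` whose direction has
  L¹-oscillation `≤ 2ρ′` on `[0,1]`, `2ρ′ ≥ (1∕m)∫|ρ−1|dμ` = the mixture path's constant oscillation (module V `exists_mixturePath`) — II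
  `abs_tilted_real_sub_le_of_pathOsc` at `S₊`; so `inf_paths ½·sup_u OSC_u = TV`, attained by the m-geodesic) · `exists_chordPath` (degenerate classes).
* §2 CLASS LEVEL in road III's letters (`…N19TiltPathRoad.core_of_tiltPath` :152): ★★★ `tiltPath_of_mass_of_tv` ((D3)(iii): MASS_cl(r₁) in p496221's
  `ℝ≥0∞` letters ∧ TV_cl(ρ) in 16b's letters ∧ bounded measurable class log-densities `μB K τ = e^{ψ₁ K τ}·μA K τ` on `T K` ⇒ a tilt path `Ψ` with ALL of
  III's path hypotheses — measurable, pointwise C¹ on ℝ, locally uniformly bounded, `Ψ 0 = 0`, run-B compatibility, class-free drift `k_K(u) = u·c_K` with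
  the MASS constant, DRIFT(r₁), OSC(2ρ) on the good non-null classes; degenerate classes ride the straight chord) · ★★ `exists_tiltPath_iff_mass_and_tv`
  (THE CIRCLE: {∃ tilt path with III's letters, DRIFT(r₁) ∧ OSC(2ρ)} ⟺ MASS_cl(r₁) ∧ TV_cl(ρ); ⇒ is III §2 `massSandwich_of_tiltPath` ∕ `tvSandwich_of_tiltPath`
  BY NAME) · `core_of_mass_of_tv_via_tiltPath` (16b's sufficiency `core_of_mass_of_tv` :170 re-derived THROUGH III `core_of_tiltPath` with the SAME width
  budget `r₁ K + (e^{2l₀B} − 1)·ρ K ≤ vol·δ K`: no constant is lost around the circle).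
READING.  In road III's chain «DENS_cl⁰ ⟹ NE7-S_cl ⟹ DRIFT ∧ OSC ⟹ MASS_cl ∧ TV_cl ⟺ {`Core` ∀ bounded `W`}» the third arrow is ⟺ as well (lens census
V69 as a tree theorem): the freedom «ANY C¹ tilt path» has zero logical leverage on the target and is a PRODUCTION interface only — a supplier may deliver
MASS_cl ∧ TV_cl as first ∕ centred-first moments of a path direction; the e-geodesic (straight chord) carries SHAPE-type data (module I
`drift_osc_of_pointwise`), the m-geodesic TV-type data exactly, no admissible path goes below TV.

HONEST FRAMING.  [folklore]; a CALIBRATION of this lineage's road III, NOT a new production interface, NOT an estimate of Bałaban's; SUPPORT-MATCHED case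
only (bounded log-densities); every datum is a HYPOTHESIS (NODE O ∕ U3 objects, produced by nobody); NE7 ∕ NE1′ NOT proved; N19 NOT discharged (0∕1);
N14 untouched; K3⁶ NOT claimed; counts UNMOVED (typed 28∕28 · discharged 5∕27 · A 5∕28); one finite four-torus programme at fixed `ε` — NOT ℝ⁴, NOT OS,
NOT a mass gap, NOT Clay.  0 `def`; 0 `sorry`; standard axioms.
-/

set_option autoImplicit false

noncomputable section

open MeasureTheory ProbabilityTheory Set Filter Topology
open scoped ENNReal

namespace Summit.QuantumFields.YangMills.BalabanUVNodes.N19TiltPathCircle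

open Summit.QuantumFields.BalabanUV.T4Continuum.NE1p.DressedMGFForm (MGFForm)
open Summit.QuantumFields.BalabanUV.T4Continuum.Spine.NE7 (Core)
open Summit.QuantumFields.YangMills.BalabanUVNodes.N19TiltPathCalculus (withDensity_exp_real tilted_real_eq_div tilted_zero_real_eq_div)
open Summit.QuantumFields.YangMills.BalabanUVNodes.N19TiltPathEndpoints (abs_tilted_real_sub_le_of_pathOsc)
open Summit.QuantumFields.YangMills.BalabanUVNodes.N19TiltPathRoad (massSandwich_of_tiltPath tvSandwich_of_tiltPath core_of_tiltPath)
open Summit.QuantumFields.YangMills.BalabanUVNodes.N19TVCurrency (real_sandwich_of_ennreal)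
open Summit.QuantumFields.YangMills.BalabanUVNodes.N19TiltPathMixture

/-! ## §1 One class, TV side: `(1∕m)∫|ρ − 1|dμ` is twice the total-variation distance; optimality of the mixture path -/
section OneClass

variable {Ω : Type*} [MeasurableSpace Ω] {μ : Measure Ω} [IsFiniteMeasure μ] [NeZero μ]
  {ψ₁ ρ : Ω → ℝ} {M Z : ℝ}

omit [NeZero μ] in
/-- Splitting `∫|ρ − 1|dμ` at `S₊ = {ρ > 1}`: `= ∫_{S₊}(ρ − 1)dμ − ∫_{S₊ᶜ}(ρ − 1)dμ`. [folklore] -/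
theorem integral_abs_sub_one_eq (hρm : Measurable ρ) (hρi : Integrable ρ μ) :
    ∫ x, |ρ x - 1| ∂μ = ∫ x in {x | 1 < ρ x}, (ρ x - 1) ∂μ - ∫ x in {x | 1 < ρ x}ᶜ, (ρ x - 1) ∂μ := by
  have hSm : MeasurableSet {x | 1 < ρ x} := measurableSet_lt measurable_const hρm
  have hi : Integrable (fun x => ρ x - 1) μ := hρi.sub (integrable_const _)
  rw [← integral_add_compl hSm hi.abs, setIntegral_congr_fun hSm (fun x (hx : 1 < ρ x) => abs_of_pos (sub_pos.2 hx)),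
    setIntegral_congr_fun hSm.compl (fun x (hx : x ∈ {x | 1 < ρ x}ᶜ) => abs_of_nonpos (by
      simp only [Set.mem_compl_iff, Set.mem_setOf_eq, not_lt] at hx; linarith)), integral_neg]
  ring

/-- **16b's TV_cl DIFFERENCE AS AN INTEGRAL.**  For `μB = e^{ψ₁}·μ`: `μB(S)∕μB(Ω) − μ(S)∕μ(Ω) = (1∕m)∫_S (ρ − 1) dμ` on every measurable `S`. [folklore] -/
theorem setDiff_eq_integral (hψm : Measurable ψ₁) (hψb : ∀ x, |ψ₁ x| ≤ M) (hZ : Z = (∫ x, Real.exp (ψ₁ x) ∂μ) / μ.real Set.univ)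
    (hρ : ∀ x, ρ x = Real.exp (ψ₁ x) / Z) {S : Set Ω} (hS : MeasurableSet S) :
    (μ.withDensity fun x => ENNReal.ofReal (Real.exp (ψ₁ x))).real S /
        (μ.withDensity fun x => ENNReal.ofReal (Real.exp (ψ₁ x))).real Set.univ - μ.real S / μ.real Set.univ =
      (μ.real Set.univ)⁻¹ * ∫ x in S, (ρ x - 1) ∂μ := by
  obtain ⟨hm, hZpos, -, -, -, -, hρi, -, hIZ⟩ := mixture_aux hψm hψb hZ hρ
  have hint : Integrable (fun x => Real.exp (ψ₁ x)) μ :=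
    N19TiltPathCalculus.integrable_of_abs_le (Real.measurable_exp.comp hψm) fun x => by
      rw [Real.abs_exp]; exact Real.exp_le_exp.2 ((le_abs_self _).trans (hψb x))
  have hρeq : ρ = fun x => Real.exp (ψ₁ x) / Z := funext hρ
  rw [withDensity_exp_real hint hS, withDensity_exp_real hint MeasurableSet.univ, setIntegral_univ, hIZ,
    integral_sub hρi.integrableOn (integrable_const _), setIntegral_const, smul_eq_mul, mul_one, hρeq, integral_div]
  field_simp

/-- ★ **SET-CLOSENESS BOUNDS THE L¹-DISTANCE OF THE DENSITIES.**  If the normalised laws of `e^{ψ₁}·μ` and `μ` are `ρ₀`-close on every measurable set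
(16b's TV_cl letter for one class), then `(1∕m)∫|ρ − 1|dμ ≤ 2ρ₀` (split at `S₊ = {ρ > 1}`). [folklore] -/
theorem integral_abs_sub_one_le_of_tv (hψm : Measurable ψ₁) (hψb : ∀ x, |ψ₁ x| ≤ M) (hZ : Z = (∫ x, Real.exp (ψ₁ x) ∂μ) / μ.real Set.univ)
    (hρ : ∀ x, ρ x = Real.exp (ψ₁ x) / Z) {ρ₀ : ℝ}
    (htv : ∀ S : Set Ω, MeasurableSet S →
      |(μ.withDensity fun x => ENNReal.ofReal (Real.exp (ψ₁ x))).real S /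
          (μ.withDensity fun x => ENNReal.ofReal (Real.exp (ψ₁ x))).real Set.univ - μ.real S / μ.real Set.univ| ≤ ρ₀) :
    (μ.real Set.univ)⁻¹ * ∫ x, |ρ x - 1| ∂μ ≤ 2 * ρ₀ := by
  obtain ⟨hm, -, -, -, -, hρm, hρi, -⟩ := mixture_aux hψm hψb hZ hρ
  have hSm : MeasurableSet {x | 1 < ρ x} := measurableSet_lt measurable_const hρm
  have h1 := htv _ hSm
  have h2 := htv _ hSm.compl
  rw [setDiff_eq_integral hψm hψb hZ hρ hSm] at h1
  rw [setDiff_eq_integral hψm hψb hZ hρ hSm.compl] at h2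
  rw [integral_abs_sub_one_eq hρm hρi, mul_sub]
  linarith [le_abs_self ((μ.real Set.univ)⁻¹ * ∫ x in {x | 1 < ρ x}, (ρ x - 1) ∂μ),
    neg_abs_le ((μ.real Set.univ)⁻¹ * ∫ x in {x | 1 < ρ x}ᶜ, (ρ x - 1) ∂μ)]

/-- **THE TOTAL-VARIATION DISTANCE IS ATTAINED AT `S₊ = {ρ > 1}`**: `½·(1∕m)∫|ρ − 1|dμ = μB(S₊)∕μB(Ω) − μ(S₊)∕μ(Ω)` (`∫(ρ − 1)dμ = 0`).  With
`integral_abs_sub_one_le_of_tv`: `½·(1∕m)∫|ρ−1|dμ = max_S |μB(S)∕μB(Ω) − μ(S)∕μ(Ω)|`, the total-variation distance of the normalised laws. [folklore] -/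
theorem half_integral_abs_eq_setDiff_pos (hψm : Measurable ψ₁) (hψb : ∀ x, |ψ₁ x| ≤ M)
    (hZ : Z = (∫ x, Real.exp (ψ₁ x) ∂μ) / μ.real Set.univ) (hρ : ∀ x, ρ x = Real.exp (ψ₁ x) / Z) :
    (1 / 2) * ((μ.real Set.univ)⁻¹ * ∫ x, |ρ x - 1| ∂μ) =
      (μ.withDensity fun x => ENNReal.ofReal (Real.exp (ψ₁ x))).real {x | 1 < ρ x} /
          (μ.withDensity fun x => ENNReal.ofReal (Real.exp (ψ₁ x))).real Set.univ - μ.real {x | 1 < ρ x} / μ.real Set.univ := by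
  obtain ⟨hm, -, -, -, -, hρm, hρi, hρ1, -⟩ := mixture_aux hψm hψb hZ hρ
  have hSm : MeasurableSet {x | 1 < ρ x} := measurableSet_lt measurable_const hρm
  have hi : Integrable (fun x => ρ x - 1) μ := hρi.sub (integrable_const _)
  have h0 : ∫ x in {x | 1 < ρ x}, (ρ x - 1) ∂μ + ∫ x in {x | 1 < ρ x}ᶜ, (ρ x - 1) ∂μ = 0 := by
    rw [integral_add_compl hSm hi, integral_sub hρi (integrable_const _), hρ1, integral_const, smul_eq_mul, mul_one, sub_self]
  have hB : ∫ x in {x | 1 < ρ x}ᶜ, (ρ x - 1) ∂μ = -∫ x in {x | 1 < ρ x}, (ρ x - 1) ∂μ := by linarith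
  rw [setDiff_eq_integral hψm hψb hZ hρ hSm, integral_abs_sub_one_eq hρm hρi, hB]
  ring

/-- ★ **OSC-OPTIMALITY OF THE MIXTURE PATH.**  For EVERY tilt path with road II's letters (measurable, pointwise C¹ on ℝ, locally uniformly bounded)
from `ψ 0 = 0` to `ψ 1 = ψ₁` whose direction has L¹-oscillation `≤ 2ρ′` on `[0,1]`: `(1∕m)∫|ρ − 1|dμ ≤ 2ρ′` — i.e. no admissible path oscillates
less than the mixture path (module V `exists_mixturePath`, OSC `≡ (1∕m)∫|ρ−1|dμ`).  Road II `abs_tilted_real_sub_le_of_pathOsc` at `S₊ = {ρ > 1}` and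
`half_integral_abs_eq_setDiff_pos`: `inf_paths ½·sup_{u∈[0,1]} OSC_u = TV`, ATTAINED. [folklore; lens K13c's claim as a theorem] -/
theorem osc_mixture_le_of_pathOsc (hψm : Measurable ψ₁) (hψb : ∀ x, |ψ₁ x| ≤ M) (hZ : Z = (∫ x, Real.exp (ψ₁ x) ∂μ) / μ.real Set.univ)
    (hρ : ∀ x, ρ x = Real.exp (ψ₁ x) / Z) {ψ ψ' : ℝ → Ω → ℝ} (hψm' : ∀ u, Measurable (ψ u)) (hψ'm : ∀ u, Measurable (ψ' u))
    (hψd : ∀ u x, HasDerivAt (fun v => ψ v x) (ψ' u x) u)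
    (hbd : ∀ u₀ : ℝ, ∃ ε > 0, ∃ M' : ℝ, ∀ u ∈ Metric.ball u₀ ε, ∀ x, |ψ u x| ≤ M' ∧ |ψ' u x| ≤ M')
    (h0 : ∀ x, ψ 0 x = 0) (h1 : ∀ x, ψ 1 x = ψ₁ x) {ρ' : ℝ}
    (hosc : ∀ u ∈ Icc (0 : ℝ) 1, ∫ x, |ψ' u x - ∫ y, ψ' u y ∂(μ.tilted (ψ u))| ∂(μ.tilted (ψ u)) ≤ 2 * ρ') :
    (μ.real Set.univ)⁻¹ * ∫ x, |ρ x - 1| ∂μ ≤ 2 * ρ' := by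
  obtain ⟨hm, -, -, -, -, hρm, -⟩ := mixture_aux hψm hψb hZ hρ
  have hint : Integrable (fun x => Real.exp (ψ₁ x)) μ :=
    N19TiltPathCalculus.integrable_of_abs_le (Real.measurable_exp.comp hψm) fun x => by
      rw [Real.abs_exp]; exact Real.exp_le_exp.2 ((le_abs_self _).trans (hψb x))
  have hSm : MeasurableSet {x | 1 < ρ x} := measurableSet_lt measurable_const hρm
  have key := abs_tilted_real_sub_le_of_pathOsc hψm' hψ'm hψd hbd hosc hSm
  have e1 : ψ 1 = ψ₁ := funext h1
  have e0 : ψ 0 = 0 := funext h0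
  rw [e1, e0, tilted_real_eq_div hint hSm, tilted_zero_real_eq_div, ← half_integral_abs_eq_setDiff_pos hψm hψb hZ hρ] at key
  linarith [le_abs_self ((1 / 2) * ((μ.real Set.univ)⁻¹ * ∫ x, |ρ x - 1| ∂μ))]

omit [IsFiniteMeasure μ] [NeZero μ] in
/-- **THE STRAIGHT CHORD** `u ↦ u·ψ₁` of a bounded measurable `ψ₁` carries road II∕III's regularity letters with `ψ 0 = 0`, `ψ 1 = ψ₁` (used for the
degenerate classes — null or outside `T K` — where nothing beyond regularity is asked). [folklore] -/
theorem exists_chordPath (hψm : Measurable ψ₁) (hψb : ∀ x, |ψ₁ x| ≤ M) :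
    ∃ ψ ψ' : ℝ → Ω → ℝ, (∀ u, Measurable (ψ u)) ∧ (∀ u, Measurable (ψ' u)) ∧ (∀ u x, HasDerivAt (fun v => ψ v x) (ψ' u x) u) ∧
      (∀ u₀ : ℝ, ∃ ε > 0, ∃ M' : ℝ, ∀ u ∈ Metric.ball u₀ ε, ∀ x, |ψ u x| ≤ M' ∧ |ψ' u x| ≤ M') ∧
      (∀ x, ψ 0 x = 0) ∧ ∀ x, ψ 1 x = ψ₁ x := by
  have hM0 : ∀ x, 0 ≤ M := fun x => (abs_nonneg _).trans (hψb x)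
  refine ⟨fun u x => u * ψ₁ x, fun _ x => ψ₁ x, fun u => hψm.const_mul u, fun _ => hψm, fun u x => ?_, fun u₀ => ?_,
    fun x => by simp, fun x => by simp⟩
  · simpa using (hasDerivAt_id u).mul_const (ψ₁ x)
  · refine ⟨1, one_pos, (|u₀| + 1) * M, fun u hu x => ⟨?_, ?_⟩⟩
    · have hu' : |u| ≤ |u₀| + 1 := by
        have := Metric.mem_ball.1 hu; rw [Real.dist_eq] at this
        linarith [abs_sub_abs_le_abs_sub u u₀]
      rw [abs_mul]; exact mul_le_mul hu' (hψb x) (abs_nonneg _) (by positivity)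
    · calc |ψ₁ x| ≤ M := hψb x
        _ = 1 * M := (one_mul M).symm
        _ ≤ (|u₀| + 1) * M := mul_le_mul_of_nonneg_right (by linarith [abs_nonneg u₀]) (hM0 x)

end OneClass

/-! ## §2 Class level in road III's letters: the converse, the circle, 16b's sufficiency via III -/
section ClassLevel

variable {ι : Type*} [DecidableEq ι] {Ω : ℕ → Type*} [∀ K, MeasurableSpace (Ω K)]
  {l₀ vol B : ℝ} {T : ℕ → Finset ι} {Bad : ℕ → ℝ → Finset ι} {W : ∀ K, Ω K → ℝ}
  {μA μB : ∀ K, ι → Measure (Ω K)} {P Q : ℕ → ℝ → ι → ℝ} {δ r₁ ρ : ℕ → ℝ} {ψ₁ : ∀ K, ι → Ω K → ℝ}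

/-- ★★★ **ROAD III's CONVERSE (LENS control (D3)(iii) `tiltPath_of_mass_of_tv`).**  Two runs' finite class pieces on the SAME class spaces with BOUNDED
measurable class log-densities (`μB K τ = e^{ψ₁ K τ}·μA K τ` on `T K` — the support-matched case); MASS_cl(r₁) in p496221's `ℝ≥0∞` letters; TV_cl(ρ) in
16b's letters.  Then there IS a tilt path carrying EVERY path hypothesis of road III `core_of_tiltPath`: exponent `Ψ K τ u` measurable, pointwise C¹ in `u`
on ℝ with measurable direction `Ψ′ K τ u`, locally uniformly bounded, `Ψ K τ 0 = 0`, run B's piece `= e^{Ψ K τ 1}·μA K τ`, a class-free drift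
`k_K(u) = u·c_K` (`c_K` the MASS constant) and, on every good non-null class and every `u ∈ [0,1]`, DRIFT `|∫Ψ′ dμ̂_u − c_K| ≤ r₁ K` and OSC `≤ 2ρ K`.
WITNESS: class by class the clamped MIXTURE path of module V (m-geodesic; DRIFT ≡ the class log-mass ratio, OSC ≡ twice the class TV distance), the
straight chord on the degenerate classes.  [folklore ∘ module V `exists_mixturePath` + §1] -/
theorem tiltPath_of_mass_of_tv (hfin : ∀ K, ∀ τ ∈ T K, IsFiniteMeasure (μA K τ))
    (hψm : ∀ K τ, Measurable (ψ₁ K τ)) (hψb : ∀ K τ, ∃ M : ℝ, ∀ x, |ψ₁ K τ x| ≤ M)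
    (hB : ∀ K, ∀ τ ∈ T K, μB K τ = (μA K τ).withDensity fun x => ENNReal.ofReal (Real.exp (ψ₁ K τ x)))
    (hM : ∀ K : ℕ, ∃ c : ℝ, ∀ t : ℝ, |t| ≤ l₀ → ∀ τ ∈ T K \ Bad K t,
      ENNReal.ofReal (Real.exp (c - r₁ K)) * μA K τ Set.univ ≤ μB K τ Set.univ ∧
        μB K τ Set.univ ≤ ENNReal.ofReal (Real.exp (c + r₁ K)) * μA K τ Set.univ)
    (hTV : ∀ (K : ℕ) (t : ℝ), |t| ≤ l₀ → ∀ τ ∈ T K \ Bad K t, ∀ S : Set (Ω K), MeasurableSet S →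
      |(μB K τ).real S / (μB K τ).real Set.univ - (μA K τ).real S / (μA K τ).real Set.univ| ≤ ρ K) :
    ∃ (Ψ Ψ' : ∀ K, ι → ℝ → Ω K → ℝ) (k k' : ℕ → ℝ → ℝ),
      (∀ K τ u, Measurable (Ψ K τ u)) ∧ (∀ K τ u, Measurable (Ψ' K τ u)) ∧
      (∀ K τ u x, HasDerivAt (fun v => Ψ K τ v x) (Ψ' K τ u x) u) ∧
      (∀ K τ (u₀ : ℝ), ∃ ε > 0, ∃ M : ℝ, ∀ u ∈ Metric.ball u₀ ε, ∀ x, |Ψ K τ u x| ≤ M ∧ |Ψ' K τ u x| ≤ M) ∧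
      (∀ K τ x, Ψ K τ 0 x = 0) ∧
      (∀ K, ∀ τ ∈ T K, μB K τ = (μA K τ).withDensity fun x => ENNReal.ofReal (Real.exp (Ψ K τ 1 x))) ∧
      (∀ K, ∀ u ∈ Icc (0 : ℝ) 1, HasDerivWithinAt (k K) (k' K u) (Icc (0 : ℝ) 1) u) ∧
      (∀ (K : ℕ) (t : ℝ), |t| ≤ l₀ → ∀ τ ∈ T K \ Bad K t, μA K τ ≠ 0 → ∀ u ∈ Icc (0 : ℝ) 1,
        |∫ x, Ψ' K τ u x ∂((μA K τ).tilted (Ψ K τ u)) - k' K u| ≤ r₁ K) ∧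
      (∀ (K : ℕ) (t : ℝ), |t| ≤ l₀ → ∀ τ ∈ T K \ Bad K t, μA K τ ≠ 0 → ∀ u ∈ Icc (0 : ℝ) 1,
        ∫ x, |Ψ' K τ u x - ∫ y, Ψ' K τ u y ∂((μA K τ).tilted (Ψ K τ u))| ∂((μA K τ).tilted (Ψ K τ u)) ≤ 2 * ρ K) := by
  classical
  choose c hc using hM
  -- class by class: a regular path with the right endpoints; on the good non-null classes the mixture data, already compared with `c_K` and `ρ K`
  have key : ∀ K τ, ∃ ψ ψ' : ℝ → Ω K → ℝ, (∀ u, Measurable (ψ u)) ∧ (∀ u, Measurable (ψ' u)) ∧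
      (∀ u x, HasDerivAt (fun v => ψ v x) (ψ' u x) u) ∧
      (∀ u₀ : ℝ, ∃ ε > 0, ∃ M' : ℝ, ∀ u ∈ Metric.ball u₀ ε, ∀ x, |ψ u x| ≤ M' ∧ |ψ' u x| ≤ M') ∧
      (∀ x, ψ 0 x = 0) ∧ (∀ x, ψ 1 x = ψ₁ K τ x) ∧
      (τ ∈ T K → μA K τ ≠ 0 → ∀ t : ℝ, |t| ≤ l₀ → τ ∈ T K \ Bad K t → ∀ u ∈ Icc (0 : ℝ) 1,
        |∫ x, ψ' u x ∂((μA K τ).tilted (ψ u)) - c K| ≤ r₁ K ∧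
        ∫ x, |ψ' u x - ∫ y, ψ' u y ∂((μA K τ).tilted (ψ u))| ∂((μA K τ).tilted (ψ u)) ≤ 2 * ρ K) := by
    intro K τ
    obtain ⟨M, hMb⟩ := hψb K τ
    by_cases h : τ ∈ T K ∧ μA K τ ≠ 0
    · haveI := hfin K τ h.1
      haveI : NeZero (μA K τ) := ⟨h.2⟩
      have hint : Integrable (fun x => Real.exp (ψ₁ K τ x)) (μA K τ) :=
        N19TiltPathCalculus.integrable_of_abs_le (Real.measurable_exp.comp (hψm K τ)) fun x => by
          rw [Real.abs_exp]; exact Real.exp_le_exp.2 ((le_abs_self _).trans (hMb x))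
      obtain ⟨hm, hZpos, -, -, -, -, -, -, hIZ⟩ :=
        mixture_aux (μ := μA K τ) (hψm K τ) hMb (Z := (∫ x, Real.exp (ψ₁ K τ x) ∂(μA K τ)) / (μA K τ).real Set.univ)
          (ρ := fun x => Real.exp (ψ₁ K τ x) / ((∫ y, Real.exp (ψ₁ K τ y) ∂(μA K τ)) / (μA K τ).real Set.univ)) rfl (fun _ => rfl)
      obtain ⟨ψ, ψ', h1, h2, h3, h4, h5, h6, h7, h8⟩ := exists_mixturePath (μ := μA K τ) (hψm K τ) hMb
        (Z := (∫ x, Real.exp (ψ₁ K τ x) ∂(μA K τ)) / (μA K τ).real Set.univ)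
        (ρ := fun x => Real.exp (ψ₁ K τ x) / ((∫ y, Real.exp (ψ₁ K τ y) ∂(μA K τ)) / (μA K τ).real Set.univ)) rfl (fun _ => rfl)
      refine ⟨ψ, ψ', h1, h2, h3, h4, h5, h6, fun hτT _ t ht hτ u hu => ⟨?_, ?_⟩⟩
      · -- DRIFT: `∫ψ′ dμ̂_u = log Z` and `e^{c − r₁} ≤ Z ≤ e^{c + r₁}` from MASS_cl
        rw [h7 u hu]
        haveI : IsFiniteMeasure (μB K τ) := by rw [hB K τ hτT]; exact isFiniteMeasure_withDensity_ofReal hint.2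
        have hsand := real_sandwich_of_ennreal (μ := μA K τ) (ν := μB K τ) (Real.exp_pos _).le (Real.exp_pos _).le (hc K t ht τ hτ)
        have hmB : (μB K τ).real Set.univ = (∫ x, Real.exp (ψ₁ K τ x) ∂(μA K τ)) / (μA K τ).real Set.univ * (μA K τ).real Set.univ := by
          rw [hB K τ hτT, withDensity_exp_real hint MeasurableSet.univ, setIntegral_univ, div_mul_cancel₀ _ hm.ne']
        rw [hmB] at hsand
        have hlo : Real.exp (c K - r₁ K) ≤ (∫ x, Real.exp (ψ₁ K τ x) ∂(μA K τ)) / (μA K τ).real Set.univ :=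
          le_of_mul_le_mul_right hsand.1 hm
        have hhi : (∫ x, Real.exp (ψ₁ K τ x) ∂(μA K τ)) / (μA K τ).real Set.univ ≤ Real.exp (c K + r₁ K) :=
          le_of_mul_le_mul_right hsand.2 hm
        rw [abs_le]
        constructor
        · have := Real.log_le_log (Real.exp_pos _) hlo; rw [Real.log_exp] at this; linarith
        · have := Real.log_le_log hZpos hhi; rw [Real.log_exp] at this; linarith
      · -- OSC: `= (1∕m)∫|ρ − 1| ≤ 2ρ K` from TV_cl
        rw [h8 u hu]
        exact integral_abs_sub_one_le_of_tv (μ := μA K τ) (hψm K τ) hMb rfl (fun _ => rfl) fun S hS => by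
          have := hTV K t ht τ hτ S hS; rwa [hB K τ hτT] at this
    · obtain ⟨ψ, ψ', h1, h2, h3, h4, h5, h6⟩ := exists_chordPath (hψm K τ) hMb
      exact ⟨ψ, ψ', h1, h2, h3, h4, h5, h6, fun hτ hne => absurd ⟨hτ, hne⟩ h⟩
  choose Ψ Ψ' hΨm hΨ'm hΨd hbd hΨ0 hΨ1 hdata using key
  refine ⟨Ψ, Ψ', fun K u => u * c K, fun K _ => c K, hΨm, hΨ'm, hΨd, hbd, hΨ0, fun K τ hτ => ?_, fun K u _ => ?_,
    fun K t ht τ hτ hne u hu => ?_, fun K t ht τ hτ hne u hu => ?_⟩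
  · simp_rw [hΨ1 K τ]; exact hB K τ hτ
  · simpa using ((hasDerivAt_id u).mul_const (c K)).hasDerivWithinAt
  · exact (hdata K τ (Finset.mem_sdiff.mp hτ).1 hne t ht hτ u hu).1
  · exact (hdata K τ (Finset.mem_sdiff.mp hτ).1 hne t ht hτ u hu).2

/-- ★★ **THE CIRCLE.**  On common class spaces with bounded measurable class log-densities (`μB K τ = e^{ψ₁ K τ}·μA K τ` on `T K`, finite pieces,
`0 ≤ ρ K`): {there is a tilt path with road III's letters whose direction has DRIFT(r₁) about a class-free drift and L¹-OSCILLATION `≤ 2ρ K` on the good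
non-null classes} ⟺ {MASS_cl(r₁) ∧ TV_cl(ρ)} — class by class, NO loss of constants either way.  ⇒ is road III §2 (`massSandwich_of_tiltPath`,
`tvSandwich_of_tiltPath`) BY NAME; ⇐ is `tiltPath_of_mass_of_tv`.  So road III's «ANY C¹ tilt path» is a PRODUCTION interface for MASS_cl ∧ TV_cl
(first ∕ centred-first moments of a path direction), never a weaker target. [folklore] -/
theorem exists_tiltPath_iff_mass_and_tv (hfin : ∀ K, ∀ τ ∈ T K, IsFiniteMeasure (μA K τ))
    (hψm : ∀ K τ, Measurable (ψ₁ K τ)) (hψb : ∀ K τ, ∃ M : ℝ, ∀ x, |ψ₁ K τ x| ≤ M)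
    (hB : ∀ K, ∀ τ ∈ T K, μB K τ = (μA K τ).withDensity fun x => ENNReal.ofReal (Real.exp (ψ₁ K τ x))) (hρ : ∀ K, 0 ≤ ρ K) :
    (∃ (Ψ Ψ' : ∀ K, ι → ℝ → Ω K → ℝ) (k k' : ℕ → ℝ → ℝ),
      (∀ K τ u, Measurable (Ψ K τ u)) ∧ (∀ K τ u, Measurable (Ψ' K τ u)) ∧
      (∀ K τ u x, HasDerivAt (fun v => Ψ K τ v x) (Ψ' K τ u x) u) ∧
      (∀ K τ (u₀ : ℝ), ∃ ε > 0, ∃ M : ℝ, ∀ u ∈ Metric.ball u₀ ε, ∀ x, |Ψ K τ u x| ≤ M ∧ |Ψ' K τ u x| ≤ M) ∧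
      (∀ K τ x, Ψ K τ 0 x = 0) ∧
      (∀ K, ∀ τ ∈ T K, μB K τ = (μA K τ).withDensity fun x => ENNReal.ofReal (Real.exp (Ψ K τ 1 x))) ∧
      (∀ K, ∀ u ∈ Icc (0 : ℝ) 1, HasDerivWithinAt (k K) (k' K u) (Icc (0 : ℝ) 1) u) ∧
      (∀ (K : ℕ) (t : ℝ), |t| ≤ l₀ → ∀ τ ∈ T K \ Bad K t, μA K τ ≠ 0 → ∀ u ∈ Icc (0 : ℝ) 1,
        |∫ x, Ψ' K τ u x ∂((μA K τ).tilted (Ψ K τ u)) - k' K u| ≤ r₁ K) ∧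
      (∀ (K : ℕ) (t : ℝ), |t| ≤ l₀ → ∀ τ ∈ T K \ Bad K t, μA K τ ≠ 0 → ∀ u ∈ Icc (0 : ℝ) 1,
        ∫ x, |Ψ' K τ u x - ∫ y, Ψ' K τ u y ∂((μA K τ).tilted (Ψ K τ u))| ∂((μA K τ).tilted (Ψ K τ u)) ≤ 2 * ρ K)) ↔
    ((∀ K : ℕ, ∃ c : ℝ, ∀ t : ℝ, |t| ≤ l₀ → ∀ τ ∈ T K \ Bad K t,
      ENNReal.ofReal (Real.exp (c - r₁ K)) * μA K τ Set.univ ≤ μB K τ Set.univ ∧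
        μB K τ Set.univ ≤ ENNReal.ofReal (Real.exp (c + r₁ K)) * μA K τ Set.univ) ∧
     (∀ (K : ℕ) (t : ℝ), |t| ≤ l₀ → ∀ τ ∈ T K \ Bad K t, ∀ S : Set (Ω K), MeasurableSet S →
      |(μB K τ).real S / (μB K τ).real Set.univ - (μA K τ).real S / (μA K τ).real Set.univ| ≤ ρ K)) := by
  constructor
  · rintro ⟨Ψ, Ψ', k, k', hΨm, hΨ'm, hΨd, hbd, hΨ0, hB', hk, hdrift, hosc⟩
    exact ⟨massSandwich_of_tiltPath hfin hΨm hΨ'm hΨd hbd hΨ0 hB' hk hdrift,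
      tvSandwich_of_tiltPath hfin hΨm hΨ'm hΨd hbd hΨ0 hB' hρ hosc⟩
  · rintro ⟨hM, hTV⟩
    exact tiltPath_of_mass_of_tv hfin hψm hψb hB hM hTV

/-- **16b's SUFFICIENCY RE-DERIVED THROUGH ROAD III — no constant is lost around the circle.**  MASS_cl(r₁) ∧ TV_cl(ρ) ∧ bounded class log-densities ⇒
`Spine.NE7.Core l₀ vol T Bad P Q δ` for every `B`-bounded MGF-form observable family under the SAME width budget `r₁ K + (e^{2l₀B} − 1)·ρ K ≤ vol·δ K`
as 16b `core_of_mass_of_tv` (which needs no log-density hypothesis): `core_of_tiltPath` applied to the mixture path of `tiltPath_of_mass_of_tv`.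
[folklore ∘ road III BY NAME] -/
theorem core_of_mass_of_tv_via_tiltPath (hP : MGFForm B T W μA P) (hQ : MGFForm B T W μB Q)
    (hψm : ∀ K τ, Measurable (ψ₁ K τ)) (hψb : ∀ K τ, ∃ M : ℝ, ∀ x, |ψ₁ K τ x| ≤ M)
    (hB : ∀ K, ∀ τ ∈ T K, μB K τ = (μA K τ).withDensity fun x => ENNReal.ofReal (Real.exp (ψ₁ K τ x))) (hρ : ∀ K, 0 ≤ ρ K)
    (hM : ∀ K : ℕ, ∃ c : ℝ, ∀ t : ℝ, |t| ≤ l₀ → ∀ τ ∈ T K \ Bad K t,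
      ENNReal.ofReal (Real.exp (c - r₁ K)) * μA K τ Set.univ ≤ μB K τ Set.univ ∧
        μB K τ Set.univ ≤ ENNReal.ofReal (Real.exp (c + r₁ K)) * μA K τ Set.univ)
    (hTV : ∀ (K : ℕ) (t : ℝ), |t| ≤ l₀ → ∀ τ ∈ T K \ Bad K t, ∀ S : Set (Ω K), MeasurableSet S →
      |(μB K τ).real S / (μB K τ).real Set.univ - (μA K τ).real S / (μA K τ).real Set.univ| ≤ ρ K)
    (hw : ∀ K, r₁ K + (Real.exp (2 * (l₀ * B)) - 1) * ρ K ≤ vol * δ K) :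
    Core l₀ vol T Bad P Q δ := by
  obtain ⟨Ψ, Ψ', k, k', hΨm, hΨ'm, hΨd, hbd, hΨ0, hB', hk, hdrift, hosc⟩ := tiltPath_of_mass_of_tv hP.finite hψm hψb hB hM hTV
  exact core_of_tiltPath hP hQ hΨm hΨ'm hΨd hbd hΨ0 hB' hρ hk hdrift hosc hw

end ClassLevel

end Summit.QuantumFields.YangMills.BalabanUVNodes.N19TiltPathCircle

end
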